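import Summits.QuantumFields.YangMills.Theorems.BalabanUVNodesN21AveragingOscillation
import Summits.QuantumFields.BalabanUV.T4Continuum.Support.MinimalActionRefine
import Summits.QuantumFields.BalabanUV.T4Continuum.Support.AveragingDeficitTwoLevelPrep
import Literature.Analysis.Complex.RungeUnits

/-!
# YM-DAG node N21 (= NE7c) — THE FINE-TEST TRANSFER: a sup-regular level-`j` configuration `U` (tree SHAPE
# `MinimalActionRefine.RegularSup d L N b c j U`: `U(n)`-valued, small field `|U(∂p) − 1| ≤ bη²`, covariant flux gradient
# `|∇_U F| ≤ cη³`, `η = L^{−j}`) has its FINE plaquette deviations two-sidedly comparable with the coarse plaquette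
# deviations of `W = rescale L (bavg L U)`: `|‖W(∂p′) − 1‖ − L²‖U(∂p₀) − 1‖| ≤ E_j` for every fine plaquette `p₀` of the
# averaging stencil of `p′`, with `E_{k+1} ≤ K·(L⁻¹)^{3k}`, `K = 4(2d+4)c + (4(d+2)(3d+8) + 14464(d+1)²(d+4)²)b²`

Track A of `YM-PLAN.md` (cell `pub-ymgap`, HUMAN RULING D-0062), node **N21** of 28; seat `pub-ymgap-dag-n21-a`, generation 3,
file 5 (files 4∕4′: `BalabanUVNodesN21AveragingLower` ∕ `…AveragingOscillation`).  `--supports stmt-QuantumFields-19182`.  Kernel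
bookkeeping: 0 `def`, 0 `sorry`, standard axioms.  COUNT-NEUTRAL.

HONEST FRAMING.  NOT PRINTED anywhere in [Bałaban 1983–89] (one run is constructed there; run A never reads run B's fine
plaquettes).  `RegularSup` is a hypothesis SHAPE of the tree (dictionary: [Balaban1985Variational] Thm 1 (8), (10) read as
pointwise bounds), asserted for NO configuration; here it is THE HYPOTHESIS `hreg` — the regularity input of N21's fine-test
junction is N16 ∕ N07 species (the minimiser's regularity), displayed BY NAME.  [folklore] composition of file 4′
(`prop1_twoSided_of_covariantStep`) with one `exp`-Lipschitz step from the flux-level covariant gradient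
(`T4AveragingDeficitWall.covGrad U (flux U)`, `F = log U(∂p)`) to the plaquette-level covariant one-step bound.  Nothing of
Bałaban's is asserted.  NOT NE7c, NOT N16; one lattice `ℤ^d`; NOT continuum ∕ OS ∕ mass gap ∕ Clay.

WHY (N21's (F∞) two-sidedness at run B's OWN test; dag-ref-B READ #53 on p410611 «GAP-STATED … run B's own fine test»).  File 3
(`BalabanUVNodesN21ClosenessJunction.dev_close_of_n16`) bounds `|u^A(p′) − u^W(p′)|`, `u^W(p′) = ‖W(∂p′) − 1‖`, `W = rescale L
(bavg L U_B)`.  Run B's own classifier ([Balaban1988Convergent] (2.17) p. 257) tests `u^B(p₀) = ‖U_B(∂p₀) − 1‖ < ε_{k+1}η_B²` on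
the FINE plaquettes `p₀`; with synchronised threshold numbers (`η_A = Lη_B`) this is `L²·u^B(p₀) < t`.  THIS FILE: `|u^W(p′) −
L²u^B(p₀)| ≤ E_{k+1}` for every fine stencil plaquette — so `|u^A(p′) − L²u^B(p₀)| ≤ C_Qθ^{13k} + E_{k+1}` (file 6) and the
four mismatch pieces of `T4IndicatorShell` §3 at run B's OWN test lie in single-run shells of that width, `E_{k+1}∕t ≤
(K∕ε)(L⁻¹)^k` against any threshold `t ≥ ε(L⁻¹)^{2k}` — the rate currency `ρ_k ≤ c₁ϑ^k` of road I again.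

CITATION HEADER (lean-in-tree rule 2026-08-18).  Tree objects BY NAME: `B7Prop1Explicit.{hol, plaqWord, bavg, cplaq, boxVec, e, U1}`,
`B7Prop2Explicit.{rescale, hol_rescale_plaqWord}`, `T4AveragingDeficitWall.{IsUnitaryCfg, SmallField, flux, fhol, covGrad, Ad, Plane}`,
`MinimalActionRefine.RegularSup`, `AveragingDeficitTwoLevelPrep.mem_U1_of_isUnitaryCfg`, `MatrixLog.{exp_mlog, norm_mlog_le_two_mul}`,
`Literature.Analysis.Complex.norm_exp_sub_exp_le` (`RungeUnits`), files 4∕4′.  Context only: T. Bałaban, Commun. Math. Phys. **98** (1985) 17–51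
[Balaban1985Averaging] ((42), (44), Prop. 1); **102** (1985) 277–309 [Balaban1985Variational] (Thm 1 (8)–(10) p. 279, the
regularity SHAPE); **119** (1988) 243–285 [Balaban1988Convergent] ((2.17) p. 257, the slot test).  No printed sentence is a
hypothesis of any declaration.

WHAT IS PROVED ([folklore]).
* §1 `covariantStep_of_covGrad`: `U(n)`-valued, `|U(∂p) − 1| ≤ a ≤ 1∕2` and `‖∇_U F(x,κ;π)‖ ≤ g` ⇒ the plaquette-level
  covariant one-step bound `‖U(x,κ)U(∂p_{x+e_κ})U(x,κ)⁻¹ − U(∂p_x)‖ ≤ g·e^{2a}` (`exp ∘ log`, `exp(uXu⁻¹) = u e^X u⁻¹`,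
  `‖e^X − e^Y‖ ≤ ‖X − Y‖e^{max(‖X‖,‖Y‖)}`, `‖log P‖ ≤ 2‖P − 1‖`).
* §2 `fine_coarse_twoSided_of_regularSup`: `RegularSup d L N b c j U`, `512(d+1)(d+4)L²b ≤ 1` ⇒ for every coarse plaquette
  `p′ = (x; π)` and fine stencil plaquette `p₀ = (L·x + r₀ + i₀e_μ + j₀e_ν; π)`:
  `L²‖U(∂p₀) − 1‖ ≤ ‖W(∂p′) − 1‖ + E_j` and `‖W(∂p′) − 1‖ ≤ L²‖U(∂p₀) − 1‖ + E_j`, `W = rescale L (bavg L U)`,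
  `E_j = L²·(2dL+4L)(γ_j + 2((3dL+8L)α_j)α_j) + 226(8(d+1)(d+4)L²α_j)²`, `α_j = b∕(L^j)²`, `γ_j = (c∕(L^j)³)·e^{2α_j}`;
  `abs_fine_coarse_of_regularSup` both at once.
* §3 `errFine_le`: `E_{k+1} ≤ K·(L⁻¹)^{3k}` with `K = 4(2d+4)c + (4(d+2)(3d+8) + 14464(d+1)²(d+4)²)·b²` (`L ≥ 1`); `relErrFine_le`:
  against any threshold `t ≥ ε(L⁻¹)^{2k}`, `E_{k+1}∕t ≤ (K∕ε)·(L⁻¹)^k`.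
-/

set_option autoImplicit false

noncomputable section

open scoped BigOperators Matrix Matrix.Norms.L2Operator
open NormedSpace Finset

namespace Summit.QuantumFields.YangMills.Theorems.N21FineTestTransfer

open Literature.MathematicalPhysics.QuantumFieldTheory.Balaban1983to89
open B7Prop1Explicit B7Prop2Explicit
open T4AveragingDeficitWall (IsUnitaryCfg SmallField flux fhol covGrad Ad Plane)
open Summit.QuantumFields.BalabanUV.T4Continuum
open MinimalActionRefine (RegularSup)
open AveragingDeficitTwoLevelPrep (mem_U1_of_isUnitaryCfg)
open N21AveragingOscillation (prop1_twoSided_of_covariantStep)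

variable {d : ℕ} {n : Type*} [Fintype n] [DecidableEq n] [Nonempty n]

/-! ## §1 From the flux-level covariant gradient to the plaquette-level covariant one-step bound -/

/-- **ONE `exp`-LIPSCHITZ STEP.**  For a `U(n)`-valued configuration with `|U(∂p) − 1| ≤ a ≤ 1∕2` on all unit plaquettes and
a pointwise bound `‖∇_U F(x,κ;π)‖ ≤ g` on the covariant forward gradient of the flux `F = log U(∂p)` in the plane `π`
(`T4AveragingDeficitWall.covGrad U (flux U)` — the currency of `RegularSup.grad`), consecutive plaquette VARIABLES differ
covariantly by at most `g·e^{2a}`: `‖U(x,κ)·U(∂p_{x+e_κ})·U(x,κ)⁻¹ − U(∂p_x)‖ ≤ g·e^{2a}`. [folklore] -/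
theorem covariantStep_of_covGrad {U : B7Prop1Explicit.Site d → Fin d → (Matrix n n ℂ)ˣ} (hU : IsUnitaryCfg U) {a : ℝ}
    (ha : a ≤ 1 / 2) (hUa : SmallField U a) (π : Plane d) {g : ℝ}
    (hgrad : ∀ (x : B7Prop1Explicit.Site d) (κ : Fin d), ‖covGrad U (flux U) x κ π‖ ≤ g)
    (x : B7Prop1Explicit.Site d) (κ : Fin d) :
    ‖(U x κ : Matrix n n ℂ) * ((hol U (x + e κ) (plaqWord π.1.1 π.1.2) : (Matrix n n ℂ)ˣ) : Matrix n n ℂ)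
          * (((U x κ)⁻¹ : (Matrix n n ℂ)ˣ) : Matrix n n ℂ)
        - ((hol U x (plaqWord π.1.1 π.1.2) : (Matrix n n ℂ)ˣ) : Matrix n n ℂ)‖ ≤ g * Real.exp (2 * a) := by
  letI : NormedAlgebra ℚ (Matrix n n ℂ) := NormedAlgebra.restrictScalars ℚ ℂ (Matrix n n ℂ)
  have hne : π.1.1 ≠ π.1.2 := ne_of_lt π.2
  have hP : ‖((fhol U (x, π) : (Matrix n n ℂ)ˣ) : Matrix n n ℂ) - 1‖ ≤ a := hUa x π.1.1 π.1.2 hne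
  have hP' : ‖((fhol U (x + e κ, π) : (Matrix n n ℂ)ˣ) : Matrix n n ℂ) - 1‖ ≤ a := hUa (x + e κ) π.1.1 π.1.2 hne
  have ha1 : a < 1 := by linarith
  -- `exp ∘ log` on both plaquette variables
  have eP : exp (flux U (x, π)) = ((fhol U (x, π) : (Matrix n n ℂ)ˣ) : Matrix n n ℂ) :=
    MatrixLog.exp_mlog (lt_of_le_of_lt hP ha1)
  have eP' : exp (flux U (x + e κ, π)) = ((fhol U (x + e κ, π) : (Matrix n n ℂ)ˣ) : Matrix n n ℂ) :=
    MatrixLog.exp_mlog (lt_of_le_of_lt hP' ha1)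
  -- the transported plaquette variable is `exp` of the transported flux
  have eAd : exp (Ad (U x κ) (flux U (x + e κ, π)))
      = (U x κ : Matrix n n ℂ) * ((fhol U (x + e κ, π) : (Matrix n n ℂ)ˣ) : Matrix n n ℂ)
          * (((U x κ)⁻¹ : (Matrix n n ℂ)ˣ) : Matrix n n ℂ) := by
    unfold Ad
    rw [exp_units_conj, eP']
  -- norms of the two fluxes
  have hU1 : U x κ ∈ U1 (Matrix n n ℂ) := mem_U1_of_isUnitaryCfg hU x κ
  have hF : ‖flux U (x, π)‖ ≤ 2 * a :=
    (MatrixLog.norm_mlog_le_two_mul (hP.trans ha)).trans (by linarith)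
  have hF' : ‖Ad (U x κ) (flux U (x + e κ, π))‖ ≤ 2 * a := by
    unfold Ad
    refine (B8CurlGradHolonomy.norm_conj_le _ _ hU1.1 hU1.2).trans ?_
    exact (MatrixLog.norm_mlog_le_two_mul (hP'.trans ha)).trans (by linarith)
  -- `exp` is Lipschitz on the ball of radius `2a`
  have key := Literature.Analysis.Complex.norm_exp_sub_exp_le (Ad (U x κ) (flux U (x + e κ, π))) (flux U (x, π))
  rw [eAd, eP] at key
  have hmax : Real.exp (max ‖Ad (U x κ) (flux U (x + e κ, π))‖ ‖flux U (x, π)‖) ≤ Real.exp (2 * a) :=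
    Real.exp_le_exp.2 (max_le hF' hF)
  have hg := hgrad x κ
  unfold covGrad at hg
  have hg0 : 0 ≤ g := (norm_nonneg _).trans hg
  calc _ ≤ ‖Ad (U x κ) (flux U (x + e κ, π)) - flux U (x, π)‖
          * Real.exp (max ‖Ad (U x κ) (flux U (x + e κ, π))‖ ‖flux U (x, π)‖) := key
    _ ≤ g * Real.exp (2 * a) :=
        mul_le_mul hg hmax (Real.exp_pos _).le hg0

/-! ## §2 The two-sided fine ∕ coarse transfer for a sup-regular configuration -/

/-- **THE FINE-TEST TRANSFER.**  HYPOTHESES: `RegularSup d L N b c j U` (the tree's sup-form regularity SHAPE at level `j`: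
`U(n)`-valued, small field `|U(∂p) − 1| ≤ b∕(L^j)²`, `‖∇_U F‖ ≤ c∕(L^j)³` — asserted for no configuration; N16 ∕ N07 species)
and `512(d+1)(d+4)L²b ≤ 1`, `L ≥ 1`.  CONCLUSION: for every coarse plaquette `p′ = (x; π)` of the `L`-lattice (read through
`W = rescale L (bavg L U)`) and EVERY fine plaquette `p₀ = (L·x + r₀ + i₀e_μ + j₀e_ν; π)` of its averaging stencil
(`μ = π.1.1`, `ν = π.1.2`), with `α = b∕(L^j)²`, `γ = (c∕(L^j)³)e^{2α}`, `θ = 8(d+1)(d+4)L²α`,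
`E = L²·(2dL+4L)(γ + 2((3dL+8L)α)α) + 226θ²`:  `L²‖U(∂p₀) − 1‖ ≤ ‖W(∂p′) − 1‖ + E` and `‖W(∂p′) − 1‖ ≤ L²‖U(∂p₀) − 1‖ + E`
(file 4′ `prop1_twoSided_of_covariantStep` + §1 + `B7Prop2Explicit.hol_rescale_plaqWord`). [folklore] -/
theorem fine_coarse_twoSided_of_regularSup {L N j : ℕ} (hL : 1 ≤ L) {b c : ℝ} (hb : 0 ≤ b)
    (hbs : 512 * (d + 1) * (d + 4) * (L : ℝ) ^ 2 * b ≤ 1) {U : B7Prop1Explicit.Site d → Fin d → (Matrix n n ℂ)ˣ}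
    (hreg : RegularSup d L N b c j U) (x : B7Prop1Explicit.Site d) (π : Plane d) (r₀ : Fin d → Fin L) {i₀ j₀ : ℕ}
    (hi₀ : i₀ < L) (hj₀ : j₀ < L) :
    let α : ℝ := b / ((L : ℝ) ^ j) ^ 2
    let γ : ℝ := c / ((L : ℝ) ^ j) ^ 3 * Real.exp (2 * α)
    let E : ℝ := (L : ℝ) ^ 2 * (((2 * (d * L) + 4 * L : ℕ) : ℝ) * (γ + 2 * (((3 * (d * L) + 8 * L : ℕ) : ℝ) * α) * α))
      + 226 * (8 * (d + 1) * (d + 4) * (L : ℝ) ^ 2 * α) ^ 2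
    (L : ℝ) ^ 2 * ‖((hol U ((L : ℤ) • x + boxVec L r₀ + (i₀ : ℤ) • e π.1.1 + (j₀ : ℤ) • e π.1.2)
          (plaqWord π.1.1 π.1.2) : (Matrix n n ℂ)ˣ) : Matrix n n ℂ) - 1‖
        ≤ ‖((hol (rescale L (bavg L U)) x (plaqWord π.1.1 π.1.2) : (Matrix n n ℂ)ˣ) : Matrix n n ℂ) - 1‖ + E ∧
      ‖((hol (rescale L (bavg L U)) x (plaqWord π.1.1 π.1.2) : (Matrix n n ℂ)ˣ) : Matrix n n ℂ) - 1‖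
        ≤ (L : ℝ) ^ 2 * ‖((hol U ((L : ℤ) • x + boxVec L r₀ + (i₀ : ℤ) • e π.1.1 + (j₀ : ℤ) • e π.1.2)
          (plaqWord π.1.1 π.1.2) : (Matrix n n ℂ)ˣ) : Matrix n n ℂ) - 1‖ + E := by
  intro α γ E
  have hne : π.1.1 ≠ π.1.2 := ne_of_lt π.2
  have hLr : (1 : ℝ) ≤ L := by exact_mod_cast hL
  have hLj : (1 : ℝ) ≤ ((L : ℝ) ^ j) ^ 2 := one_le_pow₀ (one_le_pow₀ hLr)
  have hα0 : 0 ≤ α := div_nonneg hb (by positivity)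
  have hαb : α ≤ b := div_le_self hb hLj
  -- the (44) smallness of `prop1_explicit` at radius `α ≤ b`
  have hsmall : 512 * (d + 1) * (d + 4) * (L : ℝ) ^ 2 * α ≤ 1 :=
    (mul_le_mul_of_nonneg_left hαb (by positivity)).trans hbs
  have hαhalf : α ≤ 1 / 2 := by
    have hA : (4 : ℝ) ≤ ((d : ℝ) + 1) * ((d : ℝ) + 4) := by nlinarith [(Nat.cast_nonneg d : (0 : ℝ) ≤ d)]
    have hB : (1 : ℝ) ≤ (L : ℝ) ^ 2 := one_le_pow₀ hLr
    have hAB := mul_le_mul hA hB (by norm_num) (by positivity)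
    have h1 : (2 : ℝ) ≤ 512 * (d + 1) * (d + 4) * (L : ℝ) ^ 2 := by
      have : (512 : ℝ) * (d + 1) * (d + 4) * (L : ℝ) ^ 2 = 512 * (((d : ℝ) + 1) * ((d : ℝ) + 4) * (L : ℝ) ^ 2) := by
        ring
      rw [this]; linarith
    have h2 := mul_le_mul_of_nonneg_left h1 hb
    linarith
  have hV : ∀ y κ, U y κ ∈ U1 (Matrix n n ℂ) := fun y κ => mem_U1_of_isUnitaryCfg hreg.unitary y κ
  have h44 : ∀ (y : B7Prop1Explicit.Site d) (κ κ' : Fin d), κ ≠ κ' →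
      ‖((hol U y (plaqWord κ κ') : (Matrix n n ℂ)ˣ) : Matrix n n ℂ) - 1‖ ≤ α := hreg.small
  -- §1: the plaquette-level covariant one-step bound `γ`
  have hγ : ∀ (y : B7Prop1Explicit.Site d) (κ : Fin d),
      ‖(U y κ : Matrix n n ℂ) * ((hol U (y + e κ) (plaqWord π.1.1 π.1.2) : (Matrix n n ℂ)ˣ) : Matrix n n ℂ)
          * (((U y κ)⁻¹ : (Matrix n n ℂ)ˣ) : Matrix n n ℂ)
        - ((hol U y (plaqWord π.1.1 π.1.2) : (Matrix n n ℂ)ˣ) : Matrix n n ℂ)‖ ≤ γ :=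
    fun y κ => covariantStep_of_covGrad hreg.unitary hαhalf hreg.small π (fun z κ' => hreg.grad z κ' π) y κ
  -- file 4′ at the corner `L·x`, read through `hol_rescale_plaqWord`
  have h := prop1_twoSided_of_covariantStep L hL ((L : ℤ) • x) hne U hV hα0 hsmall h44 hγ r₀ hi₀ hj₀
  rw [hol_rescale_plaqWord]
  exact h

/-- **… as one absolute value**: `|‖W(∂p′) − 1‖ − L²‖U(∂p₀) − 1‖| ≤ E` under the hypotheses of
`fine_coarse_twoSided_of_regularSup`. [folklore] -/
theorem abs_fine_coarse_of_regularSup {L N j : ℕ} (hL : 1 ≤ L) {b c : ℝ} (hb : 0 ≤ b)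
    (hbs : 512 * (d + 1) * (d + 4) * (L : ℝ) ^ 2 * b ≤ 1) {U : B7Prop1Explicit.Site d → Fin d → (Matrix n n ℂ)ˣ}
    (hreg : RegularSup d L N b c j U) (x : B7Prop1Explicit.Site d) (π : Plane d) (r₀ : Fin d → Fin L) {i₀ j₀ : ℕ}
    (hi₀ : i₀ < L) (hj₀ : j₀ < L) :
    let α : ℝ := b / ((L : ℝ) ^ j) ^ 2
    let γ : ℝ := c / ((L : ℝ) ^ j) ^ 3 * Real.exp (2 * α)
    let E : ℝ := (L : ℝ) ^ 2 * (((2 * (d * L) + 4 * L : ℕ) : ℝ) * (γ + 2 * (((3 * (d * L) + 8 * L : ℕ) : ℝ) * α) * α))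
      + 226 * (8 * (d + 1) * (d + 4) * (L : ℝ) ^ 2 * α) ^ 2
    |‖((hol (rescale L (bavg L U)) x (plaqWord π.1.1 π.1.2) : (Matrix n n ℂ)ˣ) : Matrix n n ℂ) - 1‖
        - (L : ℝ) ^ 2 * ‖((hol U ((L : ℤ) • x + boxVec L r₀ + (i₀ : ℤ) • e π.1.1 + (j₀ : ℤ) • e π.1.2)
          (plaqWord π.1.1 π.1.2) : (Matrix n n ℂ)ˣ) : Matrix n n ℂ) - 1‖| ≤ E := by
  intro α γ E
  obtain ⟨h1, h2⟩ := fine_coarse_twoSided_of_regularSup hL hb hbs hreg x π r₀ hi₀ hj₀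
  rw [abs_sub_le_iff]
  constructor <;> linarith

/-! ## §3 The error in threshold units at the fine level `j = k + 1`: `E_{k+1} ≤ K·(L⁻¹)^{3k}` -/

/-- `L³·(c∕(L^{k+1})³) = c·(L⁻¹)^{3k}`. [folklore] -/
theorem pow_three_mul_div (L : ℕ) (hL : 1 ≤ L) (c : ℝ) (k : ℕ) :
    (L : ℝ) ^ 3 * (c / ((L : ℝ) ^ (k + 1)) ^ 3) = c * ((L : ℝ)⁻¹) ^ (3 * k) := by
  have hL0 : (L : ℝ) ≠ 0 := by exact_mod_cast (by omega : L ≠ 0)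
  have e1 : ((L : ℝ) ^ (k + 1)) ^ 3 = (L : ℝ) ^ 3 * (L : ℝ) ^ (3 * k) := by
    rw [← pow_mul, ← pow_add]; congr 1; ring
  rw [e1, inv_pow]
  field_simp

/-- `L⁴·(b∕(L^{k+1})²)² = b²·(L⁻¹)^{4k}`. [folklore] -/
theorem pow_four_mul_div_sq (L : ℕ) (hL : 1 ≤ L) (b : ℝ) (k : ℕ) :
    (L : ℝ) ^ 4 * (b / ((L : ℝ) ^ (k + 1)) ^ 2) ^ 2 = b ^ 2 * ((L : ℝ)⁻¹) ^ (4 * k) := by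
  have hL0 : (L : ℝ) ≠ 0 := by exact_mod_cast (by omega : L ≠ 0)
  have e1 : (((L : ℝ) ^ (k + 1)) ^ 2) ^ 2 = (L : ℝ) ^ 4 * (L : ℝ) ^ (4 * k) := by
    rw [← pow_mul, ← pow_mul, ← pow_add]; congr 1; ring
  rw [div_pow, e1, inv_pow]
  field_simp

/-- **THE ERROR IN THRESHOLD UNITS.**  At the fine level `j = k + 1` (`L ≥ 1`, `0 ≤ b, c`, `512(d+1)(d+4)L²b ≤ 1`) the error
of §2 satisfies `E_{k+1} ≤ K·(L⁻¹)^{3k}` with `K = 4(2d+4)c + (4(d+2)(3d+8) + 14464(d+1)²(d+4)²)·b²` — one power `L⁻¹` per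
level MORE than the squared spacing `(L⁻¹)^{2k}` of the coarse small-field thresholds. [folklore] -/
theorem errFine_le {L : ℕ} (hL : 1 ≤ L) {b c : ℝ} (hb : 0 ≤ b) (hc : 0 ≤ c)
    (hbs : 512 * (d + 1) * (d + 4) * (L : ℝ) ^ 2 * b ≤ 1) (k : ℕ) :
    let α : ℝ := b / ((L : ℝ) ^ (k + 1)) ^ 2
    let γ : ℝ := c / ((L : ℝ) ^ (k + 1)) ^ 3 * Real.exp (2 * α)
    (L : ℝ) ^ 2 * (((2 * (d * L) + 4 * L : ℕ) : ℝ) * (γ + 2 * (((3 * (d * L) + 8 * L : ℕ) : ℝ) * α) * α))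
        + 226 * (8 * (d + 1) * (d + 4) * (L : ℝ) ^ 2 * α) ^ 2
      ≤ (4 * (2 * d + 4) * c + (4 * (d + 2) * (3 * d + 8) + 14464 * (d + 1) ^ 2 * (d + 4) ^ 2) * b ^ 2)
          * ((L : ℝ)⁻¹) ^ (3 * k) := by
  intro α γ
  have hLr : (1 : ℝ) ≤ L := by exact_mod_cast hL
  have hL0 : (0 : ℝ) < L := by linarith
  have hq0 : (0 : ℝ) ≤ (L : ℝ)⁻¹ := inv_nonneg.2 hL0.le
  have hq1 : ((L : ℝ))⁻¹ ≤ 1 := inv_le_one_of_one_le₀ hLr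
  have hLj : (1 : ℝ) ≤ ((L : ℝ) ^ (k + 1)) ^ 2 := one_le_pow₀ (one_le_pow₀ hLr)
  have hα0 : 0 ≤ α := div_nonneg hb (by positivity)
  have hαb : α ≤ b := div_le_self hb hLj
  have hαhalf : 2 * α ≤ 1 := by
    have hA : (4 : ℝ) ≤ ((d : ℝ) + 1) * ((d : ℝ) + 4) := by nlinarith [(Nat.cast_nonneg d : (0 : ℝ) ≤ d)]
    have hB : (1 : ℝ) ≤ (L : ℝ) ^ 2 := one_le_pow₀ hLr
    have hAB := mul_le_mul hA hB (by norm_num) (by positivity)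
    have h1 : (2 : ℝ) ≤ 512 * (d + 1) * (d + 4) * (L : ℝ) ^ 2 := by
      have : (512 : ℝ) * (d + 1) * (d + 4) * (L : ℝ) ^ 2 = 512 * (((d : ℝ) + 1) * ((d : ℝ) + 4) * (L : ℝ) ^ 2) := by
        ring
      rw [this]; linarith
    have h2 := mul_le_mul_of_nonneg_left h1 hb
    linarith
  -- `e^{2α} ≤ e ≤ 4`
  have hexp : Real.exp (2 * α) ≤ 4 := by
    have := Real.exp_le_exp.2 hαhalf
    have h3 : Real.exp 1 ≤ 4 := by
      have := Real.exp_one_lt_d9; norm_num at this ⊢; linarith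
    linarith
  have hγ0 : 0 ≤ γ := by positivity
  -- the three terms against `(L⁻¹)^{3k}`
  have hq34 : ((L : ℝ)⁻¹) ^ (4 * k) ≤ ((L : ℝ)⁻¹) ^ (3 * k) := pow_le_pow_of_le_one hq0 hq1 (by omega)
  have t1 : (L : ℝ) ^ 2 * (((2 * (d * L) + 4 * L : ℕ) : ℝ) * γ)
      ≤ 4 * (2 * d + 4) * c * ((L : ℝ)⁻¹) ^ (3 * k) := by
    have e1 : (L : ℝ) ^ 2 * (((2 * (d * L) + 4 * L : ℕ) : ℝ) * γ)
        = (2 * d + 4) * Real.exp (2 * α) * ((L : ℝ) ^ 3 * (c / ((L : ℝ) ^ (k + 1)) ^ 3)) := by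
      push_cast; ring
    rw [e1, pow_three_mul_div L hL c k]
    have : (2 * (d : ℝ) + 4) * Real.exp (2 * α) * (c * ((L : ℝ)⁻¹) ^ (3 * k))
        ≤ (2 * (d : ℝ) + 4) * 4 * (c * ((L : ℝ)⁻¹) ^ (3 * k)) := by
      gcongr
    linarith
  have t2 : (L : ℝ) ^ 2 * (((2 * (d * L) + 4 * L : ℕ) : ℝ) * (2 * (((3 * (d * L) + 8 * L : ℕ) : ℝ) * α) * α))
      ≤ 4 * (d + 2) * (3 * d + 8) * b ^ 2 * ((L : ℝ)⁻¹) ^ (3 * k) := by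
    have e1 : (L : ℝ) ^ 2 * (((2 * (d * L) + 4 * L : ℕ) : ℝ) * (2 * (((3 * (d * L) + 8 * L : ℕ) : ℝ) * α) * α))
        = 4 * (d + 2) * (3 * d + 8) * ((L : ℝ) ^ 4 * (b / ((L : ℝ) ^ (k + 1)) ^ 2) ^ 2) := by
      push_cast; ring
    rw [e1, pow_four_mul_div_sq L hL b k]
    have : 4 * ((d : ℝ) + 2) * (3 * d + 8) * (b ^ 2 * ((L : ℝ)⁻¹) ^ (4 * k))
        ≤ 4 * ((d : ℝ) + 2) * (3 * d + 8) * (b ^ 2 * ((L : ℝ)⁻¹) ^ (3 * k)) := by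
      gcongr
    linarith
  have t3 : 226 * (8 * (d + 1) * (d + 4) * (L : ℝ) ^ 2 * α) ^ 2
      ≤ 14464 * (d + 1) ^ 2 * (d + 4) ^ 2 * b ^ 2 * ((L : ℝ)⁻¹) ^ (3 * k) := by
    have e1 : 226 * (8 * (d + 1) * (d + 4) * (L : ℝ) ^ 2 * α) ^ 2
        = 14464 * (d + 1) ^ 2 * (d + 4) ^ 2 * ((L : ℝ) ^ 4 * (b / ((L : ℝ) ^ (k + 1)) ^ 2) ^ 2) := by ring
    rw [e1, pow_four_mul_div_sq L hL b k]
    have : 14464 * ((d : ℝ) + 1) ^ 2 * (d + 4) ^ 2 * (b ^ 2 * ((L : ℝ)⁻¹) ^ (4 * k))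
        ≤ 14464 * ((d : ℝ) + 1) ^ 2 * (d + 4) ^ 2 * (b ^ 2 * ((L : ℝ)⁻¹) ^ (3 * k)) := by
      gcongr
    linarith
  have esplit : (L : ℝ) ^ 2 * (((2 * (d * L) + 4 * L : ℕ) : ℝ) * (γ + 2 * (((3 * (d * L) + 8 * L : ℕ) : ℝ) * α) * α))
      = (L : ℝ) ^ 2 * (((2 * (d * L) + 4 * L : ℕ) : ℝ) * γ)
        + (L : ℝ) ^ 2 * (((2 * (d * L) + 4 * L : ℕ) : ℝ) * (2 * (((3 * (d * L) + 8 * L : ℕ) : ℝ) * α) * α)) := by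
    ring
  rw [esplit]
  nlinarith [t1, t2, t3]

/-- **RELATIVE WIDTH AT RUN B's OWN TEST.**  Against any coarse threshold `t ≥ ε·(L⁻¹)^{2k}` (`ε > 0`) the fine-test error is
RELATIVELY small at the geometric rate `L⁻¹`: `E_{k+1}∕t ≤ (K∕ε)·(L⁻¹)^k` — the rate currency `ρ_k ≤ c₁ϑ^k` of road I
(`n21_knit_levels`) with `c₁ = K∕ε`, `ϑ = L⁻¹` (`≤ θ` of file 3, since `θ⁶ = L⁻¹`). [folklore] -/
theorem relErrFine_le {L : ℕ} (hL : 1 ≤ L) {b c : ℝ} (hb : 0 ≤ b) (hc : 0 ≤ c)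
    (hbs : 512 * (d + 1) * (d + 4) * (L : ℝ) ^ 2 * b ≤ 1) (k : ℕ) {ε t : ℝ} (hε : 0 < ε)
    (ht : ε * ((L : ℝ)⁻¹) ^ (2 * k) ≤ t) :
    let α : ℝ := b / ((L : ℝ) ^ (k + 1)) ^ 2
    let γ : ℝ := c / ((L : ℝ) ^ (k + 1)) ^ 3 * Real.exp (2 * α)
    ((L : ℝ) ^ 2 * (((2 * (d * L) + 4 * L : ℕ) : ℝ) * (γ + 2 * (((3 * (d * L) + 8 * L : ℕ) : ℝ) * α) * α))
        + 226 * (8 * (d + 1) * (d + 4) * (L : ℝ) ^ 2 * α) ^ 2) / t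
      ≤ (4 * (2 * d + 4) * c + (4 * (d + 2) * (3 * d + 8) + 14464 * (d + 1) ^ 2 * (d + 4) ^ 2) * b ^ 2) / ε
          * ((L : ℝ)⁻¹) ^ k := by
  intro α γ
  have hL0 : (0 : ℝ) < (L : ℝ) := by exact_mod_cast (by omega : 0 < L)
  have hq : 0 < ((L : ℝ))⁻¹ := inv_pos.2 hL0
  have ht0 : 0 < t := lt_of_lt_of_le (mul_pos hε (pow_pos hq _)) ht
  have hK : 0 ≤ 4 * (2 * d + 4) * c + (4 * (d + 2) * (3 * d + 8) + 14464 * (d + 1) ^ 2 * (d + 4) ^ 2) * b ^ 2 := by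
    positivity
  have hE := errFine_le (d := d) hL hb hc hbs k
  rw [div_le_iff₀ ht0]
  refine hE.trans ?_
  have e3 : ((L : ℝ)⁻¹) ^ (3 * k) = ((L : ℝ)⁻¹) ^ k * ((L : ℝ)⁻¹) ^ (2 * k) := by rw [← pow_add]; congr 1; ring
  rw [e3]
  calc (4 * (2 * d + 4) * c + (4 * (d + 2) * (3 * d + 8) + 14464 * (d + 1) ^ 2 * (d + 4) ^ 2) * b ^ 2)
          * (((L : ℝ)⁻¹) ^ k * ((L : ℝ)⁻¹) ^ (2 * k))
      = (4 * (2 * d + 4) * c + (4 * (d + 2) * (3 * d + 8) + 14464 * (d + 1) ^ 2 * (d + 4) ^ 2) * b ^ 2) / ε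
          * ((L : ℝ)⁻¹) ^ k * (ε * ((L : ℝ)⁻¹) ^ (2 * k)) := by
        field_simp
    _ ≤ _ := mul_le_mul_of_nonneg_left ht (mul_nonneg (div_nonneg hK hε.le) (pow_nonneg hq.le k))

end Summit.QuantumFields.YangMills.Theorems.N21FineTestTransfer

end
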